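import Literature.NumberTheory.Rogawski1990.UnitFundamentalLemmaInertFlickerScalarsCM     -- ★ p841179 (F0) FILE 4 (the `|2|_v = 1` consumer)
import Literature.NumberTheory.Rogawski1990.UnitFundamentalLemmaInertFlickerFrame         -- ★ p840795 `isUnit_two_integer_iff_valued_eq_one`
import HarnessLib

/-!
# `|2|_w = 1 ⟺ |2|_v = 1 ⟺ v ∤ 2` for a place `w ∣ v`: the line's «`p ≠ 2`» binder `IsUnit (2 : 𝒪[L_w])` read on the base `L⁺_v`
# (Flicker 1998 §1 p. 74; Cassels–Fröhlich Ch. II §10)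

Topic `NumberTheory/Rogawski1990`; namespace `Literature.NumberTheory.Rogawski1990`.  **Theorems only** (no `def`, no instance, no notation, no named
fact, no `sorry`); imports = tree.  The line «N7nsCount» carries Flicker's standing «`p ≠ 2`» as `(h2 : IsUnit (2 : 𝒪[w.1.adicCompletion L]))` at the place
`w ∣ v` of `L`, while ★ `exists_flicker_scalars_of_nonsplit` (the scalars `e, π, x, y` feeding ★ `exists_four_matched_flicker_representatives` ∕ the count junction)
reads `(h2 : Valued.v (2 : v.adicCompletion L⁺) = 1)` on the base.  This file is the two-line bridge: `2 ∈ 𝔪_w ⟺ 2 ∈ 𝔪_v` for `w` over `v`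
(`w.under = v`, so `𝔪_v = 𝔪_w ∩ 𝓞_{L⁺}`), valuations of the integer `2` read through ★ Mathlib `valuation_eq_one_iff_notMem`.

* `two_mem_asIdeal_iff_of_placesOver` · `valued_two_eq_one_iff_two_notMem` · **`valued_two_eq_one_iff_of_placesOver`** (`|2|_w = 1 ↔ |2|_v = 1`) ·
  **`isUnit_two_integer_iff_valued_two_base_eq_one`** (`IsUnit (2 : 𝒪[L_w]) ↔ |2|_v = 1`) · **`exists_flicker_scalars_of_nonsplit'`** (★ FILE 4 in the
  stub's binder).

## References
* Y. Z. Flicker, *Elementary proof of the fundamental lemma for a unitary group*, Canad. J. Math. 50 (1998), §1 p. 74 (`p > 2`) [Flicker1998UnitaryFL].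
* J. W. S. Cassels, A. Fröhlich (eds.), *Algebraic Number Theory* (1967), Ch. II §10 [CasselsFrohlichANT1967].
-/

set_option autoImplicit false

noncomputable section

open NumberField IsDedekindDomain
open scoped ValuativeRel

namespace Literature.NumberTheory.Rogawski1990

open Literature.NumberTheory.Automorphic Literature.NumberTheory.Automorphic.UnitaryGroup

section Generic

variable {K : Type*} [Field K] [NumberField K]

/-- `|2|_v = 1 ⟺ 2 ∉ 𝔪_v` for a finite place `v` of a number field. [cite: CasselsFrohlichANT1967, Ch. II §10] -/
theorem valued_two_eq_one_iff_two_notMem (v : HeightOneSpectrum (𝓞 K)) :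
    Valued.v (2 : v.adicCompletion K) = 1 ↔ (2 : 𝓞 K) ∉ v.asIdeal := by
  have h := HeightOneSpectrum.valuedAdicCompletion_eq_valuation' (v := v) ((2 : 𝓞 K) : K)
  have h2' : ((2 : 𝓞 K) : K) = 2 := map_ofNat (algebraMap (𝓞 K) K) 2
  have h2 : (((2 : 𝓞 K) : K) : v.adicCompletion K) = 2 := by
    rw [h2']
    exact map_ofNat (algebraMap K (v.adicCompletion K)) 2
  rw [h2] at h
  rw [h]
  exact HeightOneSpectrum.valuation_eq_one_iff_notMem (K := K) v

end Generic

section CM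

variable (L : Type) [Field L] [NumberField L] [IsCMField L] {v : HeightOneSpectrum (𝓞 ↥(maximalRealSubfield L))}

omit [NumberField L] [IsCMField L] in
/-- `2 ∈ 𝔪_w ⟺ 2 ∈ 𝔪_v` for a place `w` of `L` over the place `v` of `L⁺` (`𝔪_v = 𝔪_w ∩ 𝓞_{L⁺}`). [cite: CasselsFrohlichANT1967, Ch. II §10] -/
theorem two_mem_asIdeal_iff_of_placesOver (w : PlacesOver L v) :
    (2 : 𝓞 L) ∈ w.1.asIdeal ↔ (2 : 𝓞 ↥(maximalRealSubfield L)) ∈ v.asIdeal := by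
  have hv : (w.1.under (𝓞 ↥(maximalRealSubfield L))).asIdeal = v.asIdeal := congrArg HeightOneSpectrum.asIdeal w.2
  rw [← hv, HeightOneSpectrum.under_asIdeal, Ideal.under, Ideal.mem_comap, map_ofNat]

omit [IsCMField L] in
/-- **`|2|_w = 1 ⟺ |2|_v = 1`** for `w ∣ v`. [cite: CasselsFrohlichANT1967, Ch. II §10] [cite: Flicker1998UnitaryFL, §1 p. 74] -/
theorem valued_two_eq_one_iff_of_placesOver (w : PlacesOver L v) :
    Valued.v (2 : w.1.adicCompletion L) = 1 ↔ Valued.v (2 : v.adicCompletion ↥(maximalRealSubfield L)) = 1 := by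
  rw [valued_two_eq_one_iff_two_notMem, valued_two_eq_one_iff_two_notMem, not_iff_not, two_mem_asIdeal_iff_of_placesOver]

omit [IsCMField L] in
/-- **The line's binder on the base**: `IsUnit (2 : 𝒪[L_w]) ⟺ |2|_v = 1` (★ `isUnit_two_integer_iff_valued_eq_one` + the previous).
[cite: Flicker1998UnitaryFL, §1 p. 74] [cite: CasselsFrohlichANT1967, Ch. II §10] -/
theorem isUnit_two_integer_iff_valued_two_base_eq_one (w : PlacesOver L v) :
    IsUnit (2 : 𝒪[w.1.adicCompletion L]) ↔ Valued.v (2 : v.adicCompletion ↥(maximalRealSubfield L)) = 1 := by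
  rw [isUnit_two_integer_iff_valued_eq_one L w.1, valued_two_eq_one_iff_of_placesOver]

/-- **FLICKER'S SCALARS IN THE STUB'S BINDER**: ★ `exists_flicker_scalars_of_nonsplit` with `(h2 : IsUnit (2 : 𝒪[L_w]))` (the spelling of
`stub_countSplitClause`) in place of `|2|_v = 1`. [cite: Flicker1998UnitaryFL, §2 Prop. 3 p. 79] [cite: Omeara1963, §63C Example 63:16] -/
theorem exists_flicker_scalars_of_nonsplit' (w : PlacesOver L v) (hw : IsCMField.complexConj L • w.1 = w.1)
    (hunr : Algebra.IsUnramifiedIn (𝓞 L) v.asIdeal) (h2 : IsUnit (2 : 𝒪[w.1.adicCompletion L])) :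
    ∃ e π x y : UnitaryGroup.LocalRing L v,
      2 * e = 1 ∧ UnitaryGroup.conjLocal L (IsCMField.complexConj L) v π = π ∧ IsUnit π ∧
        (∀ z, UnitaryGroup.conjLocal L (IsCMField.complexConj L) v z * z ≠ π) ∧
        UnitaryGroup.conjLocal L (IsCMField.complexConj L) v x * x = 2 ∧ UnitaryGroup.conjLocal L (IsCMField.complexConj L) v y * y = -2 :=
  exists_flicker_scalars_of_nonsplit L v w hw hunr ((isUnit_two_integer_iff_valued_two_base_eq_one L w).1 h2)

end CM

end Literature.NumberTheory.Rogawski1990
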